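import Summits.ResolutionOfSingularities.ResolutionOfSingularities.Theorems.FrobeniusLadderFRationalResolutionEtaleRoofLocalization
import Summits.ResolutionOfSingularities.ResolutionOfSingularities.Theorems.FrobeniusLadderFRationalResolutionConeChartBlowupPoints
import Summits.ResolutionOfSingularities.ResolutionOfSingularities.Theorems.FrobeniusLadderFRationalResolutionEtaleBlowupComparison
import Summits.ResolutionOfSingularities.ResolutionOfSingularities.Theorems.FrobeniusLadderFRationalResolutionBlowupRegularOffCentre
import Summits.ResolutionOfSingularities.ResolutionOfSingularities.Theorems.FrobeniusLadderFRationalResolutionTwoStepHloc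
import Literature.AlgebraicGeometry.Resolution.AffineBlowupIntegral
import HarnessLib

/-!
# Crux `FrobeniusLadder.FRationalResolution` (stmt-ResolutionOfSingularities-15317), line `redirect`,
# stub `stub_diagonalizableQuotientResolution` — **THE POINT-BLOW-UP RECURSION, scheme side** (bricks P7-c3′ and
# P7-d′ of memo MEMO-15317-leafhand2-g8 §8–§9: strong induction on the measure `d` of a cone chart algebra point,
# surface case over ARBITRARY fields)

DATA (the invariant of the memo, §2): an integral `X`, locally of finite type over a field `k`, finitely many
singular points; a base `(A, P, φ, 𝔭)` log regular (`P` fs spanning, zero-dimensional stratum `𝔪_{A_𝔭} ≤ I(𝔭)A_𝔭`,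
`dim A_𝔭 ≤ 2`); a cone chart algebra `(C, Q, χ)` over it ((χ), (gen), (D), (K), (Ω), `Q.FG`, cone in normal form
`ℤF_𝔭 + {m u + l e : l ≥ 0, a l ≤ d m}`, `a < d`); its fixed prime `𝔓` (over `𝔭`, containing `χ(Q ∖ ℤF_𝔭)`); and an
ÉTALE ROOF `X ←ρ— Y —j↪ Spec C` through a singular point `x = ρ y` with `j y = 𝔓`.

**`hloc_of_coneChart`**: then `x` carries the local resolution datum `hloc` of `…IsolatedGlue`. Proof = one round
of the recursion: ring data from the roof (`…EtaleRoofExtraction`, `…EtaleRoofLocalization`: `Γ(X,U) → C''` étale,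
`Spec C'' ↪ Spec C`, `𝔭_x C'' = (χ s) C''`); the comparison morphisms `Bl_{𝔭_x C''} → Bl_{𝔭_x}(Spec Γ(X,U))` (étale)
and `Bl_{(χ s) C''} ↪ Bl_{(χ s)}(Spec C)` (`…EtaleBlowupComparison`); over `𝔭_x` every point of the blow-up is regular
or comes from THE fixed prime of a chart `C[(χ s)/χ(h)]` with `2 ≤ c ≤ d − 2` (`…ConeChartBlowupPoints`), off `𝔭_x`
it is regular (`…BlowupRegularOffCentre`) — so the blow-up has finitely many singular points, each carrying the
invariant with measure `c < d` and an étale roof (`IsOpenImmersion.lift` through the chart), hence `hloc` by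
induction; `…TwoStepHloc` concludes. No base case is needed (for `d ≤ 3` no fixed prime appears).

Honest label: assembly toward ONE leaf stub (no stub, crux or summit closed). No definitions, no named facts,
no sorry. [cite: Kollar2007, §2.2] [cite: Kato1994, (10.1), (10.3)] [cite: GortzWedhorn2020, Prop. 13.91]
-/

noncomputable section

-- single-problem summit: the doubled namespace component is forced
set_option linter.dupNamespace false

open CategoryTheory AlgebraicGeometry TopologicalSpace
open IsLocalRing Literature.AlgebraicGeometry.Resolution Literature.AlgebraicGeometry.Resolution.LogChart
open Summit.ResolutionOfSingularities.ResolutionOfSingularities.Theorems.FRationalResolution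

namespace Summit.ResolutionOfSingularities.ResolutionOfSingularities.Theorems.FRationalResolution.ConeChartRecursion

/-- **The étale roof at a point of a chart of `Bl_J`**: for an open immersion `Φ₂ : Y₁ → Bl_J(Spec R)`, an
étale `Φ₁ : Y₁ → X₁` and a point `y` with `Φ₂ y = awayι(q)` in the chart `D₊(x t) ≅ Spec R[J/x]`, `q ↔ 𝔔`, the open
`Φ₂⁻¹(D₊(x t))` is an étale roof `X₁ ← · ↪ Spec R[J/x]` through `Φ₁ y` and `𝔔` (`IsOpenImmersion.lift`).
[cite: GortzWedhorn2020, Prop. 13.91] -/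
theorem exists_roof_of_chart_point {R : Type} [CommRing R] (J : Ideal R) (x : R) (hx : x ∈ J)
    {Y₁ X₁ : Scheme.{0}} (Φ₂ : Y₁ ⟶ affineBlowup J) [IsOpenImmersion Φ₂] (Φ₁ : Y₁ ⟶ X₁) [Etale Φ₁] (y : Y₁)
    (q : Spec (.of (HomogeneousLocalization.Away (reesGrading J) (reesT x hx))))
    (𝔔 : Ideal (blowupAlgebra J x))
    (hpq : Proj.awayι (reesGrading J) (reesT x hx) (reesT_mem x hx) one_pos q = Φ₂ y)
    (hmemq : ∀ t, t ∈ q.asIdeal ↔ reesChartEquiv (I := J) x hx t ∈ 𝔔) :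
    ∃ (Y : Scheme.{0}) (ρ : Y ⟶ X₁) (_ : Etale ρ) (j : Y ⟶ Spec (.of (blowupAlgebra J x)))
      (_ : IsOpenImmersion j) (y₁ : Y), ρ y₁ = Φ₁ y ∧ (j y₁).asIdeal = 𝔔 := by
  let eh := RingEquiv.toCommRingCatIso (R := HomogeneousLocalization.Away (reesGrading J) (reesT x hx))
    (S := blowupAlgebra J x) (reesChartEquiv (I := J) x hx)
  let aw := Proj.awayι (reesGrading J) (reesT x hx) (reesT_mem x hx) one_pos
  let fh : Spec (.of (blowupAlgebra J x)) ⟶ affineBlowup J := Spec.map eh.hom ≫ aw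
  haveI hfh : IsOpenImmersion fh := by
    show IsOpenImmersion (Spec.map eh.hom ≫ aw)
    infer_instance
  let z₀ : Spec (.of (blowupAlgebra J x)) := Spec.map eh.inv q
  have hz₀q : Spec.map eh.hom z₀ = q := by
    show (Spec.map eh.inv ≫ Spec.map eh.hom) q = q
    rw [← Spec.map_comp, Iso.hom_inv_id, Spec.map_id]
    rfl
  have hfz₀ : fh z₀ = Φ₂ y := by
    show (Spec.map eh.hom ≫ aw) z₀ = Φ₂ y
    rw [Scheme.Hom.comp_apply, hz₀q]
    exact hpq
  have hyO : y ∈ Φ₂ ⁻¹ᵁ fh.opensRange := ⟨z₀, hfz₀⟩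
  have hrange : Set.range ⇑((Φ₂ ⁻¹ᵁ fh.opensRange).ι ≫ Φ₂) ⊆ Set.range ⇑fh := by
    rintro _ ⟨w, rfl⟩
    rw [Scheme.Hom.comp_apply]
    exact w.2
  have hfac := IsOpenImmersion.lift_fac fh ((Φ₂ ⁻¹ᵁ fh.opensRange).ι ≫ Φ₂) hrange
  haveI : IsOpenImmersion (IsOpenImmersion.lift fh ((Φ₂ ⁻¹ᵁ fh.opensRange).ι ≫ Φ₂) hrange) := by
    have : IsOpenImmersion (IsOpenImmersion.lift fh ((Φ₂ ⁻¹ᵁ fh.opensRange).ι ≫ Φ₂) hrange ≫ fh) := by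
      rw [hfac]; infer_instance
    exact IsOpenImmersion.of_comp _ fh
  refine ⟨_, (Φ₂ ⁻¹ᵁ fh.opensRange).ι ≫ Φ₁, inferInstance,
    IsOpenImmersion.lift fh ((Φ₂ ⁻¹ᵁ fh.opensRange).ι ≫ Φ₂) hrange, inferInstance, ⟨y, hyO⟩, ?_, ?_⟩
  · rw [Scheme.Hom.comp_apply, Scheme.Opens.ι_apply]
  · have h1 : fh (IsOpenImmersion.lift fh ((Φ₂ ⁻¹ᵁ fh.opensRange).ι ≫ Φ₂) hrange ⟨y, hyO⟩) = fh z₀ := by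
      rw [← Scheme.Hom.comp_apply, hfac, Scheme.Hom.comp_apply, Scheme.Opens.ι_apply, hfz₀]
    have h2 := fh.isOpenEmbedding.injective h1
    rw [h2]
    change q.asIdeal.comap eh.inv.hom = 𝔔
    ext b
    rw [Ideal.mem_comap, hmemq]
    change reesChartEquiv (I := J) x hx ((reesChartEquiv (I := J) x hx).symm b) ∈ 𝔔 ↔ b ∈ 𝔔
    rw [RingEquiv.apply_symm_apply]

set_option maxHeartbeats 800000 in
/-- **The point-blow-up recursion** (strong induction on the measure `d`). See the module docstring.
[cite: Kollar2007, §2.2] [cite: Kato1994, (10.1), (10.3)] [cite: GortzWedhorn2020, Prop. 13.91] -/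
theorem hloc_of_coneChart (d : ℕ) :
    ∀ (k : Type) [Field k] (X : Scheme.{0}) [IsIntegral X] (f : X ⟶ Spec (.of k)) [LocallyOfFiniteType f],
      (Scheme.regularLocus X)ᶜ.Finite →
    ∀ {A : Type} [CommRing A] [IsNoetherianRing A] {n : ℕ} {P : AddSubmonoid (Fin n → ℤ)}
      {φ : Multiplicative P →* A} {𝔭 : Ideal A} [𝔭.IsPrime]
      {C : Type} [CommRing C] [Algebra A C] [IsNoetherianRing C] {Q : AddSubmonoid (Fin n → ℤ)}
      {χ : Multiplicative Q →* C} {u e : Fin n → ℤ} {a : ℕ}, a < d → P.FG →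
      (∀ (w : Fin n → ℤ) (k : ℕ), 0 < k → k • w ∈ P → w ∈ P) →
      Submodule.span ℤ (P : Set (Fin n → ℤ)) = ⊤ → IsLogRegularAt P φ 𝔭 → ∀ (hPQ : P ≤ Q),
      (∀ p : P, χ (Multiplicative.ofAdd ⟨(p : Fin n → ℤ), hPQ p.2⟩) =
        algebraMap A C (φ (Multiplicative.ofAdd p))) →
      Algebra.adjoin A (Set.range χ) = ⊤ →
      (∀ q ∈ Q, ∃ p ∈ P, q + p ∈ P) →
      (∀ a : A, algebraMap A C a = 0 → ∃ p : P, φ (Multiplicative.ofAdd p) * a = 0) →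
      (∀ (K : Type) [Field K] (g : A →+* K), (∀ p : P, g (φ (Multiplicative.ofAdd p)) ≠ 0) →
        ∃ ω : C →+* K, ω.comp (algebraMap A C) = g) →
      Q.FG →
      (∀ w, w ∈ Q ↔ ∃ g ∈ Submodule.span ℤ (faceMonoid P φ 𝔭 : Set (Fin n → ℤ)), ∃ m l : ℤ,
        0 ≤ l ∧ (a : ℤ) * l ≤ (d : ℤ) * m ∧ w = g + m • u + l • e) →
      (∀ g ∈ Submodule.span ℤ (faceMonoid P φ 𝔭 : Set (Fin n → ℤ)), ∀ m l : ℤ,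
        g + m • u + l • e = 0 → m = 0 ∧ l = 0) →
      (∀ w : Fin n → ℤ, ∃ g ∈ Submodule.span ℤ (faceMonoid P φ 𝔭 : Set (Fin n → ℤ)),
        ∃ m l : ℤ, w = g + m • u + l • e) →
      maximalIdeal (Localization.AtPrime 𝔭) ≤ (ideal P φ 𝔭).map (algebraMap A (Localization.AtPrime 𝔭)) →
      ringKrullDim (Localization.AtPrime 𝔭) ≤ (2 : ℕ) →
    ∀ (𝔓 : Ideal C) [𝔓.IsPrime], 𝔓.comap (algebraMap A C) = 𝔭 →
      (∀ q : Q, (q : Fin n → ℤ) ∉ Submodule.span ℤ (faceMonoid P φ 𝔭 : Set (Fin n → ℤ)) →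
        χ (Multiplicative.ofAdd q) ∈ 𝔓) →
    ∀ {Y : Scheme.{0}} (ρ : Y ⟶ X) [Etale ρ] (j : Y ⟶ Spec (.of C)) [IsOpenImmersion j] (y : Y),
      ρ y ∉ Scheme.regularLocus X → (j y).asIdeal = 𝔓 →
      ∃ (W : X.Opens), ρ y ∈ W ∧ (∀ t : X, t ∉ Scheme.regularLocus X → t ∈ W → t = ρ y) ∧
        ∃ (Z : Scheme.{0}) (π : Z ⟶ W), IsProper π ∧ Scheme.IsRegular Z ∧
          IsIso (π ∣_ (W.ι ⁻¹ᵁ ⟨Scheme.regularLocus X, isOpen_regularLocus_of_locallyOfFiniteType_field f⟩)) ∧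
          Dense ((π ⁻¹ᵁ (W.ι ⁻¹ᵁ ⟨Scheme.regularLocus X,
            isOpen_regularLocus_of_locallyOfFiniteType_field f⟩) : Z.Opens) : Set Z) := by
  induction d using Nat.strong_induction_on with
  | _ d ih =>
  intro k _ X _ f _ hfin A _ _ n P φ 𝔭 _ C _ _ _ Q χ u e a had hP hsat hspanP hreg hPQ hχ hgen hD hK hΩ hQfg
    hQ hind hspan h0 hdimA 𝔓 _ h𝔓A h𝔓q Y ρ _ j _ y hx hjy
  classical
  -- (1) the ring-level round: the chain `s`, `J = (χ s)`, the points of `Bl_J(Spec C)` over `𝔭`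
  obtain ⟨s, hsfin, hsQ, hsL, hsgen, hcl⟩ := ConeChartBlowupPoints.stalk_regular_or_fixedPrime had hP hsat
    hspanP hreg hPQ hχ hgen hD hK hΩ hQfg hQ hind hspan h0 hdimA
  set J : Ideal C := Ideal.span ((fun q : Q => χ (Multiplicative.ofAdd q)) '' {q : Q | (q : Fin n → ℤ) ∈ s})
    with hJdef
  have hd : 0 < d := by omega
  have hmax : maximalIdeal (Localization.AtPrime 𝔓) = J.map (algebraMap C (Localization.AtPrime 𝔓)) :=
    ConeChainCharts.maximalIdeal_fixedPrime_eq_map_span hd hPQ hχ hgen hQ hind hsQ hsL hsgen h𝔓A h𝔓q h0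
  have hJ𝔓 : J ≤ 𝔓 := by
    rw [hJdef, Ideal.span_le]
    rintro _ ⟨q, hq, rfl⟩
    exact h𝔓q q (hsL _ hq)
  have hJle : 𝔓.map (algebraMap C (Localization.AtPrime 𝔓)) ≤ J.map (algebraMap C (Localization.AtPrime 𝔓)) := by
    rw [Localization.AtPrime.map_eq_maximalIdeal, hmax]
  -- (2) ring data from the roof, equalized
  obtain ⟨U, hU, hxU, _, _, _, C', _, φ', hφ', l', hl', 𝔔', _, hιf, huniq, h𝔭max, h𝔭0, hregB, h𝔔'φ, h𝔔'l⟩ :=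
    EtaleRoofExtraction.exists_affine_ring_data k X f hfin ρ j y hx
  rw [hjy] at h𝔔'l
  set 𝔭X : Ideal Γ(X, U) := (hU.primeIdealOf ⟨ρ y, hxU⟩).asIdeal with h𝔭Xdef
  haveI h𝔭Xmax : 𝔭X.IsMaximal := h𝔭max
  haveI : IsNoetherianRing Γ(X, U) := Algebra.FiniteType.isNoetherianRing k Γ(X, U)
  haveI : IsNoetherianRing C' := by
    letI : Algebra Γ(X, U) C' := φ'.toAlgebra
    haveI : Algebra.Etale Γ(X, U) C' := hφ'
    exact Algebra.FiniteType.isNoetherianRing Γ(X, U) C'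
  obtain ⟨C₂, _, _, φ₂, hφ₂, l₂, hl₂, 𝔔₂, _, h𝔔₂φ, h𝔔₂l, hJeq⟩ :=
    EtaleRoofLocalization.exists_equalized_ring_data φ' hφ' l' hl' 𝔭X 𝔓 𝔔' h𝔔'φ h𝔔'l J hJ𝔓 hJle
  haveI := hl₂
  -- (3) the blow-up `X₁ = Bl_{𝔭_x}(Spec Γ(X,U))` and the comparison morphisms
  obtain ⟨f₁, hf₁⟩ : ∃ f₁ : affineBlowup 𝔭X ⟶ Spec (.of k), f₁ = affineBlowup.π 𝔭X ≫ hU.fromSpec ≫ f :=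
    ⟨_, rfl⟩
  haveI : LocallyOfFiniteType f₁ := by rw [hf₁]; infer_instance
  haveI : IsIntegral (affineBlowup 𝔭X) := affineBlowup.isIntegral h𝔭0
  have hopen₁ : IsOpen (Scheme.regularLocus (affineBlowup 𝔭X)) :=
    isOpen_regularLocus_of_locallyOfFiniteType_field f₁
  have hopenB : IsOpen (Scheme.regularLocus (Spec (.of Γ(X, U)))) :=
    isOpen_regularLocus_of_locallyOfFiniteType_field (hU.fromSpec ≫ f)
  obtain ⟨Φ₁, hΦ₁et, hΦ₁π, hΦ₁reg, hΦ₁surj⟩ := EtaleBlowupComparison.exists_etale_comparison φ₂ hφ₂ 𝔭X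
  have hcmp := EtaleBlowupComparison.exists_openImmersion_comparison l₂ J
  rw [hJeq] at hcmp
  obtain ⟨Φ₂, hΦ₂oi, hΦ₂π, hΦ₂reg, -⟩ := hcmp
  haveI := hΦ₁et
  haveI := hΦ₂oi
  -- the point `𝔔₂` of `Spec C₂` over `𝔭_x` and over `𝔓`
  have hz₂B : Spec.map (CommRingCat.ofHom φ₂) (⟨𝔔₂, inferInstance⟩ : Spec (.of C₂)) = ⟨𝔭X, h𝔭Xmax.isPrime⟩ :=
    PrimeSpectrum.ext h𝔔₂φ
  -- (4) classification of the singular points of `X₁`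
  have hclass : ∀ y' : affineBlowup 𝔭X, y' ∉ Scheme.regularLocus (affineBlowup 𝔭X) →
      ∃ (y'' : affineBlowup (𝔭X.map φ₂)), Φ₁ y'' = y' ∧
        affineBlowup.π (𝔭X.map φ₂) y'' = (⟨𝔔₂, inferInstance⟩ : Spec (.of C₂)) ∧
      ∃ (h : Fin n → ℤ) (hhQ : h ∈ Q) (hhs : h ∈ s) (v x : Fin n → ℤ) (c : ℕ), 2 ≤ c ∧ c + 2 ≤ d ∧
        (∀ w, w ∈ blowupChartMonoid Q {q : Q | (q : Fin n → ℤ) ∈ s} ⟨h, hhQ⟩ ↔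
          ∃ g ∈ Submodule.span ℤ (faceMonoid P φ 𝔭 : Set (Fin n → ℤ)), ∃ m l : ℤ,
            0 ≤ m ∧ 0 ≤ m + (c : ℤ) * l ∧ w = g + m • v + l • x) ∧
        (∀ g ∈ Submodule.span ℤ (faceMonoid P φ 𝔭 : Set (Fin n → ℤ)), ∀ m l : ℤ,
          g + m • v + l • x = 0 → m = 0 ∧ l = 0) ∧
        (∀ w : Fin n → ℤ, ∃ g ∈ Submodule.span ℤ (faceMonoid P φ 𝔭 : Set (Fin n → ℤ)),
          ∃ m l : ℤ, w = g + m • v + l • x) ∧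
        ∃ (q : Spec (.of (HomogeneousLocalization.Away (reesGrading J) (reesT (χ (Multiplicative.ofAdd ⟨h, hhQ⟩)) (Ideal.subset_span (Set.mem_image_of_mem (fun q : Q => χ (Multiplicative.ofAdd q)) (show (⟨h, hhQ⟩ : Q) ∈ {q : Q | (q : Fin n → ℤ) ∈ s} from hhs)))))))
          (𝔔 : Ideal (blowupAlgebra J (χ (Multiplicative.ofAdd ⟨h, hhQ⟩)))) (_ : 𝔔.IsPrime),
          Proj.awayι (reesGrading J) (reesT (χ (Multiplicative.ofAdd ⟨h, hhQ⟩)) (Ideal.subset_span (Set.mem_image_of_mem (fun q : Q => χ (Multiplicative.ofAdd q)) (show (⟨h, hhQ⟩ : Q) ∈ {q : Q | (q : Fin n → ℤ) ∈ s} from hhs)))) (reesT_mem (χ (Multiplicative.ofAdd ⟨h, hhQ⟩)) (Ideal.subset_span (Set.mem_image_of_mem (fun q : Q => χ (Multiplicative.ofAdd q)) (show (⟨h, hhQ⟩ : Q) ∈ {q : Q | (q : Fin n → ℤ) ∈ s} from hhs)))) one_pos q = Φ₂ y'' ∧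
          (∀ t, t ∈ q.asIdeal ↔ reesChartEquiv (I := J) (χ (Multiplicative.ofAdd ⟨h, hhQ⟩)) (Ideal.subset_span (Set.mem_image_of_mem (fun q : Q => χ (Multiplicative.ofAdd q)) (show (⟨h, hhQ⟩ : Q) ∈ {q : Q | (q : Fin n → ℤ) ∈ s} from hhs))) t ∈ 𝔔) ∧
          𝔔.comap (algebraMap A _) = 𝔭 ∧
          (∀ qq : blowupChartMonoid Q {q : Q | (q : Fin n → ℤ) ∈ s} ⟨h, hhQ⟩,
            (qq : Fin n → ℤ) ∉ Submodule.span ℤ (faceMonoid P φ 𝔭 : Set (Fin n → ℤ)) →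
              blowupChart Q χ {q : Q | (q : Fin n → ℤ) ∈ s} ⟨h, hhQ⟩ (Multiplicative.ofAdd qq) ∈ 𝔔) ∧
          ¬ IsRegularLocalRing (Localization.AtPrime 𝔔) := by
    intro y' hy'
    -- `y'` lies over `𝔭_x`
    have hover : 𝔭X ≤ (affineBlowup.π 𝔭X y').asIdeal := by
      by_contra hnot
      apply hy'
      refine BlowupRegularOffCentre.preimage_iSup_le_regularLocus 𝔭X hopen₁ hopenB
        (fun P' hP' => hregB P' (fun heq => hP' (heq ▸ le_rfl))) y' ?_
      obtain ⟨b, hb𝔭, hby⟩ := SetLike.not_le_iff_exists.mp hnot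
      exact Opens.mem_iSup.mpr ⟨⟨b, hb𝔭⟩, (PrimeSpectrum.mem_basicOpen _ _).mpr hby⟩
    have hπy' : affineBlowup.π 𝔭X y' = ⟨𝔭X, h𝔭Xmax.isPrime⟩ :=
      PrimeSpectrum.ext ((h𝔭Xmax.eq_of_le (affineBlowup.π 𝔭X y').isPrime.ne_top hover).symm)
    obtain ⟨y'', hy''y, hy''π⟩ := hΦ₁surj y' ⟨𝔔₂, inferInstance⟩ (by rw [hπy', hz₂B])
    -- `Φ₂ y''` lies over `𝔓`, hence over `𝔭`
    have hπJ : (affineBlowup.π J (Φ₂ y'')).asIdeal = 𝔓 := by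
      have h1 : affineBlowup.π J (Φ₂ y'') = Spec.map (CommRingCat.ofHom l₂) (⟨𝔔₂, inferInstance⟩ : Spec (.of C₂)) := by
        rw [← Scheme.Hom.comp_apply, hΦ₂π, Scheme.Hom.comp_apply, hy''π]
      rw [h1]
      exact h𝔔₂l
    have hπA : (affineBlowup.π J (Φ₂ y'')).asIdeal.comap (algebraMap A C) = 𝔭 := by rw [hπJ, h𝔓A]
    rcases hcl (Φ₂ y'') hπA with hregp | ⟨h, hhQ, hhs, v, x, c, hc2, hcd, hQh, hindvx, hspanvx, q, 𝔔, h𝔔,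
        hpq, hmemq, h𝔔A, h𝔔q, hsing⟩
    · exact absurd ((hΦ₁reg y'').mp ((hΦ₂reg y'').mpr hregp)) (hy''y ▸ hy')
    · exact ⟨y'', hy''y, hy''π, h, hhQ, hhs, v, x, c, hc2, hcd, hQh, hindvx, hspanvx, q, 𝔔, h𝔔, hpq, hmemq,
        h𝔔A, h𝔔q, hsing⟩
  -- (5) the singular points of `X₁` are finitely many: on each chart `h ∈ s` there is at most one
  have hfin₁ : (Scheme.regularLocus (affineBlowup 𝔭X))ᶜ.Finite := by
    let S : (Fin n → ℤ) → Set (affineBlowup 𝔭X) := fun h => {y' | ∃ (y'' : affineBlowup (𝔭X.map φ₂))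
      (hhQ : h ∈ Q) (hhs : h ∈ s) (v x : Fin n → ℤ) (c : ℕ), Φ₁ y'' = y' ∧ 2 ≤ c ∧
        (∀ w, w ∈ blowupChartMonoid Q {q : Q | (q : Fin n → ℤ) ∈ s} ⟨h, hhQ⟩ ↔
          ∃ g ∈ Submodule.span ℤ (faceMonoid P φ 𝔭 : Set (Fin n → ℤ)), ∃ m l : ℤ,
            0 ≤ m ∧ 0 ≤ m + (c : ℤ) * l ∧ w = g + m • v + l • x) ∧
        (∀ g ∈ Submodule.span ℤ (faceMonoid P φ 𝔭 : Set (Fin n → ℤ)), ∀ m l : ℤ,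
          g + m • v + l • x = 0 → m = 0 ∧ l = 0) ∧
        (∀ w : Fin n → ℤ, ∃ g ∈ Submodule.span ℤ (faceMonoid P φ 𝔭 : Set (Fin n → ℤ)),
          ∃ m l : ℤ, w = g + m • v + l • x) ∧
        ∃ (q : Spec (.of (HomogeneousLocalization.Away (reesGrading J) (reesT (χ (Multiplicative.ofAdd ⟨h, hhQ⟩)) (Ideal.subset_span (Set.mem_image_of_mem (fun q : Q => χ (Multiplicative.ofAdd q)) (show (⟨h, hhQ⟩ : Q) ∈ {q : Q | (q : Fin n → ℤ) ∈ s} from hhs)))))))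
          (𝔔 : Ideal (blowupAlgebra J (χ (Multiplicative.ofAdd ⟨h, hhQ⟩)))) (_ : 𝔔.IsPrime),
          Proj.awayι (reesGrading J) (reesT (χ (Multiplicative.ofAdd ⟨h, hhQ⟩)) (Ideal.subset_span (Set.mem_image_of_mem (fun q : Q => χ (Multiplicative.ofAdd q)) (show (⟨h, hhQ⟩ : Q) ∈ {q : Q | (q : Fin n → ℤ) ∈ s} from hhs)))) (reesT_mem (χ (Multiplicative.ofAdd ⟨h, hhQ⟩)) (Ideal.subset_span (Set.mem_image_of_mem (fun q : Q => χ (Multiplicative.ofAdd q)) (show (⟨h, hhQ⟩ : Q) ∈ {q : Q | (q : Fin n → ℤ) ∈ s} from hhs)))) one_pos q = Φ₂ y'' ∧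
          (∀ t, t ∈ q.asIdeal ↔ reesChartEquiv (I := J) (χ (Multiplicative.ofAdd ⟨h, hhQ⟩)) (Ideal.subset_span (Set.mem_image_of_mem (fun q : Q => χ (Multiplicative.ofAdd q)) (show (⟨h, hhQ⟩ : Q) ∈ {q : Q | (q : Fin n → ℤ) ∈ s} from hhs))) t ∈ 𝔔) ∧
          𝔔.comap (algebraMap A _) = 𝔭 ∧ ¬ IsRegularLocalRing (Localization.AtPrime 𝔔)}
    have hsub : (Scheme.regularLocus (affineBlowup 𝔭X))ᶜ ⊆ ⋃ h ∈ s, S h := by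
      intro y' hy'
      obtain ⟨y'', hy''y, -, h, hhQ, hhs, v, x, c, hc2, -, hQh, hindvx, hspanvx, q, 𝔔, h𝔔, hpq, hmemq,
        h𝔔A, -, hsing⟩ := hclass y' hy'
      exact Set.mem_biUnion hhs ⟨y'', hhQ, hhs, v, x, c, hy''y, hc2, hQh, hindvx, hspanvx, q, 𝔔, h𝔔, hpq, hmemq,
        h𝔔A, hsing⟩
    refine (hsfin.biUnion fun h _ => Set.Subsingleton.finite ?_).subset hsub
    rintro y₁' ⟨y₁'', hhQ₁, hhs₁, v₁, x₁, c₁, hΦy₁, hc₁, hQh₁, hind₁, hspan₁, q₁, 𝔔₁, h𝔔₁, hpq₁, hmem₁, hA₁,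
      hsing₁⟩ y₂' ⟨y₂'', hhQ₂, hhs₂, v₂, x₂, c₂, hΦy₂, hc₂, hQh₂, hind₂, hspan₂, q₂, 𝔔₂', h𝔔₂', hpq₂, hmem₂,
      hA₂, hsing₂⟩
    haveI := h𝔔₁
    haveI := h𝔔₂'
    haveI : IsNoetherianRing (blowupAlgebra J (χ (Multiplicative.ofAdd ⟨h, hhQ₁⟩))) :=
      isNoetherianRing_blowupAlgebra_of_isNoetherianRing _ _
    have hspan₁' : ∀ w : Fin n → ℤ, ∃ g ∈ Submodule.span ℤ (faceMonoid P φ 𝔭 : Set (Fin n → ℤ)),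
        ∃ m l : ℤ, w = g + m • v₁ + l • x₁ := hspan₁
    -- THE fixed prime of the chart at `h`: every other prime over `𝔭` is regular
    obtain ⟨𝔓h, h𝔓hprime, h𝔓hA, -, -, -, hregother, -⟩ := ConeChartNextRound.exists_fixedPrime_package hc₁ hsfin
      hP hsat hspanP hreg hPQ hχ hgen hD hK hΩ hQfg hhQ₁ hQh₁ hind₁ hspan₁' h0 hdimA
    have he₁ : 𝔔₁ = 𝔓h := by
      by_contra hne; exact hsing₁ (hregother 𝔔₁ hA₁ hne)
    have he₂ : 𝔔₂' = 𝔓h := by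
      by_contra hne; exact hsing₂ (hregother 𝔔₂' hA₂ hne)
    have h𝔔eq : 𝔔₁ = 𝔔₂' := he₁.trans he₂.symm
    have hqeq : q₁ = q₂ := PrimeSpectrum.ext (Ideal.ext fun t => by rw [hmem₁, hmem₂, h𝔔eq])
    have hΦ₂eq : Φ₂ y₁'' = Φ₂ y₂'' := by rw [← hpq₁, ← hpq₂, hqeq]
    have hyeq : y₁'' = y₂'' := Φ₂.isOpenEmbedding.injective hΦ₂eq
    rw [← hΦy₁, ← hΦy₂, hyeq]
  -- (6) `hloc` at every singular point of `X₁`, by induction (measure `c ≤ d - 2`)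
  have hloc₁ : ∀ y' : affineBlowup 𝔭X, y' ∉ Scheme.regularLocus (affineBlowup 𝔭X) →
      ∃ (V : (affineBlowup 𝔭X).Opens), y' ∈ V ∧
        (∀ t : affineBlowup 𝔭X, t ∉ Scheme.regularLocus (affineBlowup 𝔭X) → t ∈ V → t = y') ∧
        ∃ (Y' : Scheme.{0}) (ρ' : Y' ⟶ V), IsProper ρ' ∧ Scheme.IsRegular Y' ∧
          IsIso (ρ' ∣_ (V.ι ⁻¹ᵁ ⟨Scheme.regularLocus (affineBlowup 𝔭X), hopen₁⟩)) ∧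
          Dense ((ρ' ⁻¹ᵁ (V.ι ⁻¹ᵁ ⟨Scheme.regularLocus (affineBlowup 𝔭X), hopen₁⟩) : Y'.Opens) : Set Y') := by
    intro y' hy'
    obtain ⟨y'', hy''y, hy''π, h, hhQ, hhs, v, x, c, hc2, hcd, hQh, hindvx, hspanvx, q, 𝔔, h𝔔, hpq, hmemq,
      h𝔔A, h𝔔q, hsing⟩ := hclass y' hy'
    haveI := h𝔔
    haveI : IsNoetherianRing (blowupAlgebra J (χ (Multiplicative.ofAdd ⟨h, hhQ⟩))) :=
      isNoetherianRing_blowupAlgebra_of_isNoetherianRing _ _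
    -- the invariant with measure `c` on the chart ring `C_h = C[(χ s)/χ(h)]`
    obtain ⟨-, -, -, -, -, -, -, hχ₂, hgen₂, hD₂, hK₂, hΩ₂, hfg₂, hcone, hind', hspan'⟩ :=
      ConeChartNextRound.exists_fixedPrime_package hc2 hsfin hP hsat hspanP hreg hPQ hχ hgen hD hK hΩ hQfg hhQ
        hQh hindvx hspanvx h0 hdimA
    -- the étale roof at `y'`: `X₁ ←Φ₁— Φ₂⁻¹(D₊(χ(h) t)) —lift↪ Spec C_h`
    have hχh : χ (Multiplicative.ofAdd ⟨h, hhQ⟩) ∈ J :=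
      Ideal.subset_span (Set.mem_image_of_mem (fun q : Q => χ (Multiplicative.ofAdd q))
        (show (⟨h, hhQ⟩ : Q) ∈ {q : Q | (q : Fin n → ℤ) ∈ s} from hhs))
    obtain ⟨Y₁, ρ₁, _, j₁, _, y₁, hρ₁y, hj₁y⟩ :=
      exists_roof_of_chart_point J _ hχh Φ₂ Φ₁ y'' q 𝔔 hpq hmemq
    rw [hy''y] at hρ₁y
    have hx₁ : ρ₁ y₁ ∉ Scheme.regularLocus (affineBlowup 𝔭X) := by rw [hρ₁y]; exact hy'
    have key := ih c (by omega) k (affineBlowup 𝔭X) f₁ hfin₁ (a := c - 1) (u := x) (e := v - x)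
      (C := blowupAlgebra J (χ (Multiplicative.ofAdd ⟨h, hhQ⟩)))
      (Q := blowupChartMonoid Q {q : Q | (q : Fin n → ℤ) ∈ s} ⟨h, hhQ⟩)
      (χ := blowupChart Q χ {q : Q | (q : Fin n → ℤ) ∈ s} ⟨h, hhQ⟩) (by omega) hP hsat hspanP hreg
      (hPQ.trans (le_blowupChartMonoid Q _ ⟨h, hhQ⟩)) hχ₂ hgen₂ hD₂ hK₂ hΩ₂ hfg₂ hcone hind' hspan' h0 hdimA
      𝔔 h𝔔A h𝔔q ρ₁ j₁ y₁ hx₁ hj₁y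
    rw [hρ₁y] at key
    exact key
  -- (7) conclude by the two-step model on the affine open `U`
  have hsingB : (⟨𝔭X, h𝔭Xmax.isPrime⟩ : Spec (.of Γ(X, U))) ∉ Scheme.regularLocus (Spec (.of Γ(X, U))) := by
    intro hreg'
    have h1 := (mem_regularLocus_iff_of_flat_of_isPreimmersion hU.fromSpec _).mp hreg'
    have h2 : hU.fromSpec ⟨𝔭X, h𝔭Xmax.isPrime⟩ = ρ y := hU.fromSpec_primeIdealOf ⟨ρ y, hxU⟩
    rw [h2] at h1
    exact hx h1
  have hRegI : ∀ P' : Spec (.of Γ(X, U)),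
      P' ∈ Scheme.regularLocus (Spec (.of Γ(X, U))) ↔ ¬ 𝔭X ≤ P'.asIdeal := by
    intro P'
    constructor
    · intro hP' hle
      have : P' = ⟨𝔭X, h𝔭Xmax.isPrime⟩ :=
        PrimeSpectrum.ext (h𝔭Xmax.eq_of_le P'.isPrime.ne_top hle).symm
      rw [this] at hP'
      exact hsingB hP'
    · intro hnle
      exact hregB P' (fun heq => hnle (heq ▸ le_rfl))
  have hq : ∀ t : Spec (.of Γ(X, U)), 𝔭X ≤ t.asIdeal → t = ⟨𝔭X, h𝔭Xmax.isPrime⟩ := fun t ht =>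
    PrimeSpectrum.ext (h𝔭Xmax.eq_of_le t.isPrime.ne_top ht).symm
  have hres := TwoStepHloc.hloc_of_two_step_affineOpen k X f Γ(X, U) hU.fromSpec hιf 𝔭X
    (IsNoetherian.noetherian 𝔭X) h𝔭0 hRegI ⟨𝔭X, h𝔭Xmax.isPrime⟩ hq hopen₁ hfin₁ hloc₁
  have hpt : hU.fromSpec ⟨𝔭X, h𝔭Xmax.isPrime⟩ = ρ y := hU.fromSpec_primeIdealOf ⟨ρ y, hxU⟩
  rw [hpt] at hres
  exact hres

end Summit.ResolutionOfSingularities.ResolutionOfSingularities.Theorems.FRationalResolution.ConeChartRecursion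

end
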